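import Summits.FinalStateConjecture.FinalStateConjecture.Theorems.EIHFluxBalanceInertialRecessionVirialTwoBody

/-!
# Route EIHFluxBalance — crux `InertialRecession`, abstract endgame for general `N`:
# two static estimates for the class-versus-body case of LEMMA SPLIT

Helper file for the crux `stmt-FinalStateConjecture-10166` (virial route, `work/split/PLAN.md`, next provable case). Mathlib-only.
* `norm_coldVelocity_sub_le` — the cold velocity `V̂(P) = P/√(M² + ‖P‖²)` is `(6/M)`-Lipschitz in the momentum;
* `abs_virial_le` — the virial functional of a member set is bounded by `M_𝒦 Γ · diam`:
  `|Σ_{𝒦} ⟨Mⱼγⱼwⱼ, ξⱼ − ξ_c⟩| ≤ (Σ_{𝒦} Mⱼ)(1 − k²)^{-1/2} D` when `‖wⱼ‖ ≤ k < 1` and all mutual distances are `≤ D`.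
-/

noncomputable section

open Finset Filter Topology

namespace Summit.FinalStateConjecture.FinalStateConjecture.Theorems.SublinearIsFree.Virial

open Literature.Geometry.Lorentzian

variable {N : ℕ}

/-- **The cold velocity is Lipschitz in the momentum**: `‖V̂(P) − V̂(Q)‖ ≤ 6‖P − Q‖/M`. [folklore] -/
theorem norm_coldVelocity_sub_le {MB : ℝ} (hMB : 0 < MB) (P Q : E3) :
    ‖(√(MB ^ 2 + ‖P‖ ^ 2))⁻¹ • P - (√(MB ^ 2 + ‖Q‖ ^ 2))⁻¹ • Q‖ ≤ 6 * ‖P - Q‖ / MB := by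
  have hEP : MB ≤ √(MB ^ 2 + ‖P‖ ^ 2) := by
    rw [Real.le_sqrt hMB.le (by positivity)]; nlinarith [norm_nonneg P]
  have hEQ : MB ≤ √(MB ^ 2 + ‖Q‖ ^ 2) := by
    rw [Real.le_sqrt hMB.le (by positivity)]; nlinarith [norm_nonneg Q]
  have hEP' : ‖P‖ ≤ √(MB ^ 2 + ‖P‖ ^ 2) := by
    rw [Real.le_sqrt (norm_nonneg _) (by positivity)]; nlinarith [sq_nonneg MB]
  have hEQ' : ‖Q‖ ≤ √(MB ^ 2 + ‖Q‖ ^ 2) := by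
    rw [Real.le_sqrt (norm_nonneg _) (by positivity)]; nlinarith [sq_nonneg MB]
  have hΔE : |√(MB ^ 2 + ‖P‖ ^ 2) - √(MB ^ 2 + ‖Q‖ ^ 2)| ≤ ‖P - Q‖ := by
    have h1 := sqrt_sq_add_norm_sq_le_add MB P Q
    have h2 := sqrt_sq_add_norm_sq_le_add MB Q P
    rw [norm_sub_rev] at h2
    rw [abs_le]; constructor <;> linarith
  have hcomp : ∀ k : Fin 3, |((√(MB ^ 2 + ‖P‖ ^ 2))⁻¹ • P - (√(MB ^ 2 + ‖Q‖ ^ 2))⁻¹ • Q) k| ≤ 2 * ‖P - Q‖ / MB := by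
    intro k
    have hPk : |P k| ≤ √(MB ^ 2 + ‖P‖ ^ 2) := by
      have h1 : ‖P k‖ ≤ ‖P‖ := PiLp.norm_apply_le P k
      rw [Real.norm_eq_abs] at h1
      exact h1.trans hEP'
    have hQk : |Q k| ≤ √(MB ^ 2 + ‖Q‖ ^ 2) := by
      have h1 : ‖Q k‖ ≤ ‖Q‖ := PiLp.norm_apply_le Q k
      rw [Real.norm_eq_abs] at h1
      exact h1.trans hEQ'
    have h := abs_div_sub_div_le (p₁ := Q k) (p₂ := P k) hMB hEQ hEP hQk
    have heq : ((√(MB ^ 2 + ‖P‖ ^ 2))⁻¹ • P - (√(MB ^ 2 + ‖Q‖ ^ 2))⁻¹ • Q) k =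
        P k / √(MB ^ 2 + ‖P‖ ^ 2) - Q k / √(MB ^ 2 + ‖Q‖ ^ 2) := by
      simp only [PiLp.sub_apply, PiLp.smul_apply, smul_eq_mul]
      ring
    rw [heq]
    refine h.trans ?_
    rw [div_le_div_iff_of_pos_right hMB]
    have hdk : |P k - Q k| ≤ ‖P - Q‖ := by
      have h1 : ‖(P - Q) k‖ ≤ ‖P - Q‖ := PiLp.norm_apply_le (P - Q) k
      rwa [PiLp.sub_apply, Real.norm_eq_abs] at h1
    linarith
  calc ‖(√(MB ^ 2 + ‖P‖ ^ 2))⁻¹ • P - (√(MB ^ 2 + ‖Q‖ ^ 2))⁻¹ • Q‖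
      ≤ ∑ k, |((√(MB ^ 2 + ‖P‖ ^ 2))⁻¹ • P - (√(MB ^ 2 + ‖Q‖ ^ 2))⁻¹ • Q) k| := Endgame.norm_le_sum_abs _
    _ ≤ ∑ _k : Fin 3, 2 * ‖P - Q‖ / MB := Finset.sum_le_sum fun k _ ↦ hcomp k
    _ = 6 * ‖P - Q‖ / MB := by simp; ring

/-- **The virial functional is bounded by `M_𝒦 Γ · diam`** (static form). [folklore] -/
theorem abs_virial_le (𝒦 : Finset (Fin N)) (M : Fin N → ℝ) (hM : ∀ i, 0 < M i) (hne : 𝒦.Nonempty) {k : ℝ}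
    (hk2 : 0 < 1 - k ^ 2) (ξ w : Fin N → E3) (hw : ∀ i, ‖w i‖ ≤ k) {D : ℝ}
    (hD : ∀ x ∈ 𝒦, ∀ y ∈ 𝒦, ‖ξ x - ξ y‖ ≤ D) :
    |∑ j ∈ 𝒦, inner ℝ ((M j * (√(1 - ‖w j‖ ^ 2))⁻¹) • w j) (ξ j - (∑ l ∈ 𝒦, M l)⁻¹ • ∑ l ∈ 𝒦, M l • ξ l)| ≤
      (∑ i ∈ 𝒦, M i) * (√(1 - k ^ 2))⁻¹ * D := by
  obtain ⟨x₀, hx₀⟩ := hne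
  have hk0 : 0 ≤ k := (norm_nonneg _).trans (hw x₀)
  have hk1 : k < 1 := by nlinarith
  have hw1 : ∀ i, ‖w i‖ < 1 := fun i ↦ (hw i).trans_lt hk1
  have hD0 : 0 ≤ D := (norm_nonneg _).trans (hD x₀ hx₀ x₀ hx₀)
  have hΓ : ∀ i, (√(1 - ‖w i‖ ^ 2))⁻¹ ≤ (√(1 - k ^ 2))⁻¹ := fun i ↦ by
    refine inv_anti₀ (Real.sqrt_pos.mpr hk2) (Real.sqrt_le_sqrt ?_)
    nlinarith [hw i, norm_nonneg (w i)]
  refine (Finset.abs_sum_le_sum_abs _ _).trans ?_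
  have hterm : ∀ j ∈ 𝒦, |inner ℝ ((M j * (√(1 - ‖w j‖ ^ 2))⁻¹) • w j)
      (ξ j - (∑ l ∈ 𝒦, M l)⁻¹ • ∑ l ∈ 𝒦, M l • ξ l)| ≤ M j * (√(1 - k ^ 2))⁻¹ * D := by
    intro j hj
    refine (abs_real_inner_le_norm _ _).trans ?_
    have hγ0 : 0 < (√(1 - ‖w j‖ ^ 2))⁻¹ :=
      inv_pos.mpr (Real.sqrt_pos.mpr (by nlinarith [hw1 j, norm_nonneg (w j)]))
    have h1 : ‖(M j * (√(1 - ‖w j‖ ^ 2))⁻¹) • w j‖ ≤ M j * (√(1 - k ^ 2))⁻¹ := by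
      rw [norm_smul, Real.norm_eq_abs, abs_of_pos (mul_pos (hM j) hγ0)]
      calc M j * (√(1 - ‖w j‖ ^ 2))⁻¹ * ‖w j‖ ≤ M j * (√(1 - ‖w j‖ ^ 2))⁻¹ * 1 :=
            mul_le_mul_of_nonneg_left (hw1 j).le (mul_pos (hM j) hγ0).le
        _ ≤ M j * (√(1 - k ^ 2))⁻¹ := by
            rw [mul_one]; exact mul_le_mul_of_nonneg_left (hΓ j) (hM j).le
    have h2 : ‖ξ j - (∑ l ∈ 𝒦, M l)⁻¹ • ∑ l ∈ 𝒦, M l • ξ l‖ ≤ D :=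
      norm_sub_centre_le (ξ := ξ) (M := M) (S := 𝒦) (A := 𝒦) hM subset_rfl ⟨x₀, hx₀⟩ hj hD
    exact mul_le_mul h1 h2 (norm_nonneg _) (mul_pos (hM j) (inv_pos.mpr (Real.sqrt_pos.mpr hk2))).le
  refine (Finset.sum_le_sum hterm).trans ?_
  rw [← Finset.sum_mul, ← Finset.sum_mul]


/-- **LEMMA SPLIT for `N ≤ 2`** (`split_of_isolated_pair` with no other body). [folklore] -/
theorem split_of_le_two (M : Fin N → ℝ) (ξ v : Fin N → ℝ → E3) (κ : ℝ)
    (P : ℝ → E3 → ℝ → Fin 4 → ℝ) (hM : ∀ i, 0 < M i) (hκ0 : 0 < κ) (hκ1 : κ < 1)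
    (hξ : ∀ i, ContDiff ℝ ((⊤ : ℕ∞) : WithTop ℕ∞) (ξ i))
    (hcone : ∀ i, ∀ᶠ t in atTop, ‖ξ i t‖ ≤ κ ^ 2 * t)
    (hsep : ∀ i j, i ≠ j → Tendsto (fun t ↦ ‖ξ i t - ξ j t‖) atTop atTop) (hvc : ∀ i, Continuous (v i))
    (hk : ∃ k : ℝ, 0 ≤ k ∧ k < 1 ∧ ∀ i t, ‖v i t‖ ≤ k)
    (hslave : ∀ i, Tendsto (fun t ↦ deriv (ξ i) t - v i t) atTop (𝓝 0))
    (hWL : ∀ ρ : ℝ → ℝ, Tendsto ρ atTop atTop → ∀ δ : ℝ, 0 < δ → δ < 1 → ∃ (C T : ℝ),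
      ∀ (t₁ t₂ : ℝ) (c : ℝ → E3) (R : ℝ → ℝ), T ≤ t₁ → t₁ ≤ t₂ →
      (∀ s ∈ Set.Icc t₁ t₂, ∀ s' ∈ Set.Icc t₁ t₂, ‖c s - c s'‖ ≤ 2 * |s - s'| ∧ |R s - R s'| ≤ 2 * |s - s'|) →
      (∀ s ∈ Set.Icc t₁ t₂, ρ s ≤ δ * R s ∧ ‖c s‖ + R s ≤ (κ + κ ^ 2) / 2 * s ∧
        ∀ j, ‖ξ j s - c s‖ ≤ (1 - δ) * R s ∨ (1 + δ) * R s ≤ ‖ξ j s - c s‖) →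
      ∀ μ : Fin 4, |P t₂ (c t₂) (R t₂) μ - P t₁ (c t₁) (R t₁) μ| ≤ C * ∫ s in t₁..t₂, (R s ^ (3 / 2 : ℝ))⁻¹)
    (hID : ∀ ρ : ℝ → ℝ, Tendsto ρ atTop atTop → ∀ δ : ℝ, 0 < δ → δ < 1 → ∃ (T : ℝ) (ζ : ℝ → ℝ),
      Tendsto ζ atTop (𝓝 0) ∧ ∀ (t : ℝ) (c : E3) (R : ℝ) (A : Finset (Fin N)), T ≤ t → ρ t ≤ δ * R →
      ‖c‖ + R ≤ (κ + κ ^ 2) / 2 * t → (∀ j, ‖ξ j t - c‖ ≤ (1 - δ) * R ∨ (1 + δ) * R ≤ ‖ξ j t - c‖) →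
      (∀ j, j ∈ A ↔ ‖ξ j t - c‖ ≤ (1 - δ) * R) →
      |P t c R 0 - ∑ j ∈ A, M j * (√(1 - ‖v j t‖ ^ 2))⁻¹| ≤ ζ t ∧
      ∀ k : Fin 3, |P t c R k.succ - ∑ j ∈ A, M j * (√(1 - ‖v j t‖ ^ 2))⁻¹ * v j t k| ≤ ζ t)
    (hN : N ≤ 2) (i j : Fin N) :
    (∃ σ : ℝ, 0 < σ ∧ ∀ᶠ t in atTop, σ * t ≤ ‖ξ j t - ξ i t‖) ∨
      ∀ η : ℝ, 0 < η → ∀ᶠ t in atTop, ‖ξ j t - ξ i t‖ ≤ η * t := by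
  classical
  by_cases hij : i = j
  · right
    intro η hη
    subst hij
    filter_upwards [eventually_ge_atTop 0] with t ht
    rw [sub_self, norm_zero]
    positivity
  -- every body is `i` or `j`, so the isolation of the pair is vacuous
  have hij' : ∀ x : Fin N, x = i ∨ x = j := by
    intro x
    by_contra h
    push Not at h
    have h3 : ({x, i, j} : Finset (Fin N)).card = 3 := by
      rw [Finset.card_insert_of_notMem (by simp [h.1, h.2]), Finset.card_pair hij]
    have := Finset.card_le_card (Finset.subset_univ ({x, i, j} : Finset (Fin N)))
    rw [h3, Finset.card_fin] at this
    omega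
  exact split_of_isolated_pair M ξ v κ P hM hκ0 hκ1 hξ hcone hsep hvc hk hslave hWL hID i j one_pos
    (Eventually.of_forall fun t x _ z hz ↦ absurd (by rcases hij' z with rfl | rfl <;> simp) hz)

/-- **The conclusion of `stub_pairwiseDichotomy` for `N ≤ 2`** (`split_of_le_two` + `pairwiseDichotomy_of_split`). [folklore] -/
theorem pairwiseDichotomy_of_le_two (M : Fin N → ℝ) (ξ v : Fin N → ℝ → E3) (κ : ℝ)
    (P : ℝ → E3 → ℝ → Fin 4 → ℝ) (hM : ∀ i, 0 < M i) (hκ0 : 0 < κ) (hκ1 : κ < 1)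
    (hξ : ∀ i, ContDiff ℝ ((⊤ : ℕ∞) : WithTop ℕ∞) (ξ i))
    (hcone : ∀ i, ∀ᶠ t in atTop, ‖ξ i t‖ ≤ κ ^ 2 * t)
    (hsep : ∀ i j, i ≠ j → Tendsto (fun t ↦ ‖ξ i t - ξ j t‖) atTop atTop) (hvc : ∀ i, Continuous (v i))
    (hk : ∃ k : ℝ, 0 ≤ k ∧ k < 1 ∧ ∀ i t, ‖v i t‖ ≤ k)
    (hslave : ∀ i, Tendsto (fun t ↦ deriv (ξ i) t - v i t) atTop (𝓝 0))
    (hWL : ∀ ρ : ℝ → ℝ, Tendsto ρ atTop atTop → ∀ δ : ℝ, 0 < δ → δ < 1 → ∃ (C T : ℝ),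
      ∀ (t₁ t₂ : ℝ) (c : ℝ → E3) (R : ℝ → ℝ), T ≤ t₁ → t₁ ≤ t₂ →
      (∀ s ∈ Set.Icc t₁ t₂, ∀ s' ∈ Set.Icc t₁ t₂, ‖c s - c s'‖ ≤ 2 * |s - s'| ∧ |R s - R s'| ≤ 2 * |s - s'|) →
      (∀ s ∈ Set.Icc t₁ t₂, ρ s ≤ δ * R s ∧ ‖c s‖ + R s ≤ (κ + κ ^ 2) / 2 * s ∧
        ∀ j, ‖ξ j s - c s‖ ≤ (1 - δ) * R s ∨ (1 + δ) * R s ≤ ‖ξ j s - c s‖) →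
      ∀ μ : Fin 4, |P t₂ (c t₂) (R t₂) μ - P t₁ (c t₁) (R t₁) μ| ≤ C * ∫ s in t₁..t₂, (R s ^ (3 / 2 : ℝ))⁻¹)
    (hID : ∀ ρ : ℝ → ℝ, Tendsto ρ atTop atTop → ∀ δ : ℝ, 0 < δ → δ < 1 → ∃ (T : ℝ) (ζ : ℝ → ℝ),
      Tendsto ζ atTop (𝓝 0) ∧ ∀ (t : ℝ) (c : E3) (R : ℝ) (A : Finset (Fin N)), T ≤ t → ρ t ≤ δ * R →
      ‖c‖ + R ≤ (κ + κ ^ 2) / 2 * t → (∀ j, ‖ξ j t - c‖ ≤ (1 - δ) * R ∨ (1 + δ) * R ≤ ‖ξ j t - c‖) →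
      (∀ j, j ∈ A ↔ ‖ξ j t - c‖ ≤ (1 - δ) * R) →
      |P t c R 0 - ∑ j ∈ A, M j * (√(1 - ‖v j t‖ ^ 2))⁻¹| ≤ ζ t ∧
      ∀ k : Fin 3, |P t c R k.succ - ∑ j ∈ A, M j * (√(1 - ‖v j t‖ ^ 2))⁻¹ * v j t k| ≤ ζ t)
    (hN : N ≤ 2) (i j : Fin N) :
    (∃ σ : ℝ, 0 < σ ∧ ∀ᶠ t in atTop, σ * t ≤ ‖ξ j t - ξ i t‖) ∨
      Tendsto (fun t ↦ v j t - v i t) atTop (𝓝 0) :=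
  pairwiseDichotomy_of_split M ξ v κ P hM hκ0 hκ1 hξ hcone hsep hvc hk hslave hWL hID
    (split_of_le_two M ξ v κ P hM hκ0 hκ1 hξ hcone hsep hvc hk hslave hWL hID hN) i j

/-- Registered one-line form of `norm_coldVelocity_sub_le`. [folklore] -/
theorem norm_coldVelocity_sub_le' : open Literature.Geometry.Lorentzian in ∀ {MB : ℝ}, 0 < MB → ∀ (P Q : E3), ‖(√(MB ^ 2 + ‖P‖ ^ 2))⁻¹ • P - (√(MB ^ 2 + ‖Q‖ ^ 2))⁻¹ • Q‖ ≤ 6 * ‖P - Q‖ / MB :=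
  fun hMB P Q ↦ norm_coldVelocity_sub_le hMB P Q

end Summit.FinalStateConjecture.FinalStateConjecture.Theorems.SublinearIsFree.Virial

end
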